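import Summits.FinalStateConjecture.FinalStateConjecture.Theorems.SoloInformedCombGenericity

/-!
# SoloInformed — positive tame codimension forces good data `wDist`-near every exceptional datum

Soloist `solo-FinalStateConjecture-informed` (session 6, 2026-08-18). A kernel fact about the QUANTIFIER
SHAPE of the summit `FinalStateConjecture` (no geometry is used), companion to
`SoloInformedNecessaryWCC.lean` and `SoloInformedCombGenericity.lean`:

* `exists_nonexceptional_wDist_lt`: if `𝓔` has tame codimension `≥ m ≥ 1` inside `𝓓`
  (`InitialDataSet.HasTameCodimAtLeastIn`), then through every `d ∈ 𝓔` there is an end `e` such that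
  for every `ε > 0` some datum of `𝓓 ∖ 𝓔` lies within `e.wDist`-distance `ε` of `d`: the witness family
  is `wDist`-continuous at `c = 0` (`IsTameDataFamily`) and its members with `c ≠ 0` are non-exceptional,
  and `ℝᵐ`, `m ≥ 1`, has points `c ≠ 0` in every neighbourhood of `0`.
* `finalStateConjecture_good_near_exceptional`: hence the final state conjecture implies that the GOOD
  data (MGHD exists, complete `𝓘⁺`, `C²` settling to sub-extremal Kerr black holes plus radiation) are
  `wDist`-dense at every exceptional datum: for every `d ∈ 𝓔_W ∪ 𝓔_S` and every `ε > 0` there is an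
  admissible good datum `d'` with `e.wDist d' d < ε` on some end `e`.

Why this is recorded. The typed admissible class weights only two derivatives of `h` and one of `k`
(`AFEnd.wDist`, `IsStronglyAsymptoticallyFlatDR`), while the conclusion asks for unweighted `C²` settling.
The lemma is the formal hook of the soloist's observation (paper/SHARPEST.md §0 (G4)(b),(c)) that a proof
of the summit must produce GOOD data inside every `wDist`-ball around any exceptional datum — in
particular, if data carrying thin focusing far-field shells are exceptional, good data that are
`C²`-weighted-close to them (hence still `C³`-large) — i.e. it must contain a low-regularity global
statement; the lemma itself is elementary and unconditional.

References: [Christodoulou1999] p. A24; [DafermosRodnianski2013] App. B.2.3; [DafermosLuk2017] §1.2.1.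
-/

open Literature.Geometry.Lorentzian
open scoped Manifold ContDiff ENNReal Topology
open Filter Set

set_option linter.dupNamespace false

namespace Summit.FinalStateConjecture.FinalStateConjecture.Theorems

/-- **Positive tame codimension puts non-exceptional data `wDist`-near every exceptional datum.**
If `𝓔` has tame codimension at least `m ≥ 1` inside `𝓓`, then for every `d ∈ 𝓔` there is an
asymptotically flat end `e` (the end carrying the witness family) such that for every `ε > 0` some
`d' ∈ 𝓓`, `d' ∉ 𝓔`, has `e.wDist d' d < ε`. [cite: Christodoulou1999, p. A24] -/
theorem exists_nonexceptional_wDist_lt {X : Type*} [TopologicalSpace X] [ChartedSpace E3 X]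
    [IsManifold (𝓡 3) ∞ X] {𝓓 𝓔 : Set (InitialDataSet (𝓡 3) X)} {m : ℕ} (hm : m ≠ 0)
    (h : InitialDataSet.HasTameCodimAtLeastIn 𝓓 𝓔 m) {d : InitialDataSet (𝓡 3) X}
    (hd : d ∈ 𝓔) :
    ∃ e : AFEnd X, ∀ ε : ℝ≥0∞, 0 < ε → ∃ d' ∈ 𝓓, d' ∉ 𝓔 ∧ e.wDist d' d < ε := by
  obtain ⟨e, F, hF, -, h0, -, hD, hE⟩ := h d hd
  refine ⟨e, fun ε hε ↦ ?_⟩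
  have hT : Tendsto (fun c ↦ e.wDist (F c) (F 0)) (𝓝 0) (𝓝 0) := hF.2.2.2
  have hS : {c : EuclideanSpace ℝ (Fin m) | e.wDist (F c) (F 0) < ε} ∈
      𝓝 (0 : EuclideanSpace ℝ (Fin m)) :=
    hT (Iio_mem_nhds hε)
  obtain ⟨δ, hδ, hball⟩ := Metric.mem_nhds_iff.mp hS
  let i : Fin m := ⟨0, Nat.pos_of_ne_zero hm⟩
  let c : EuclideanSpace ℝ (Fin m) := EuclideanSpace.single i (δ / 2)
  have hci : c i = δ / 2 := by simp [c]
  have hc0 : c ≠ 0 := by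
    intro h0'
    have h1 : (δ / 2 : ℝ) = 0 := by
      rw [← hci, h0']
      rfl
    linarith
  have hcball : c ∈ Metric.ball (0 : EuclideanSpace ℝ (Fin m)) δ := by
    rw [Metric.mem_ball, dist_zero_right]
    have hn : ‖c‖ = ‖(δ / 2 : ℝ)‖ := PiLp.norm_single 2 (fun _ : Fin m ↦ ℝ) i (δ / 2)
    rw [hn, Real.norm_eq_abs, abs_of_pos (by positivity)]
    linarith
  refine ⟨F c, hD c, hE c hc0, ?_⟩
  have hlt : e.wDist (F c) (F 0) < ε := hball hcball
  rwa [h0] at hlt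

/-- **The final state conjecture forces good data `wDist`-near every exceptional datum.** If
`FinalStateConjecture` holds then, on every admissible `3`-manifold `Σ`, for every datum `d` in the
exceptional set `𝓔_W(Σ) ∪ 𝓔_S(Σ)` (`censorshipExceptional`, `settlingExceptional`; by
`exceptional_eq_union` this is exactly the summit's exceptional set) there is an end `e` such that for
every `ε > 0` some admissible datum `d'` OUTSIDE `𝓔_W ∪ 𝓔_S` — one having an MGHD, all of whose MGHDs
have complete `𝓘⁺` and settle in `C²` to sub-extremal Kerr black holes plus radiation — satisfies
`e.wDist d' d < ε`. Since `wDist` weights only two derivatives of `h` and one of `k`, good data must in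
particular be found `C²`-weighted-close to any exceptional datum, however rough the latter is in `C³`.
[cite: Christodoulou1999, p. A24] [cite: DafermosLuk2017, §1.2.1] -/
theorem finalStateConjecture_good_near_exceptional (hFSC : FinalStateConjecture) (X : Type)
    [TopologicalSpace X] [ChartedSpace E3 X] [IsManifold (𝓡 3) ∞ X] [T2Space X]
    [SecondCountableTopology X] [ConnectedSpace X] {d : InitialDataSet (𝓡 3) X}
    (hd : d ∈ censorshipExceptional X ∪ settlingExceptional X) :
    ∃ e : AFEnd X, ∀ ε : ℝ≥0∞, 0 < ε →
      ∃ d' ∈ admissibleVacuumData X,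
        d' ∉ censorshipExceptional X ∪ settlingExceptional X ∧ e.wDist d' d < ε :=
  exists_nonexceptional_wDist_lt one_ne_zero (finalStateConjecture_iff_union.mp hFSC X) hd

end Summit.FinalStateConjecture.FinalStateConjecture.Theorems
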